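import Summits.AtomisticToContinuum.Crystallization.Theorems.ChartedZeroExcessLayeredLatticeLiouvilleXK

/-!
# Zero-excess layered lattice Liouville — part XL (lens-2 g59, node «SBGlueC3»): E3-scale budgets — top scale and the two regimes

Critic rows 1127/1135 (C3 «top scale + large-ρ regime explicit») for leaf (2) `SubWindowBudgetGlueBPG` of `stmt-AtomisticToContinuum-26636`.
Every bond-energy budget at an E3 radius `ρ` about the centre atom `x = atomOf X₀` — the far budgets `Θ_ℓ` fed to (I4ˢ) at each level AND the final
[SBᵇ] claim — comes from exactly two sources, priced here once:

* XL.1 WINDOWS IN THE ROOT WINDOW: `inter_ball_subset_atomsIn`, `inter_closedBall_atomOf_subset_atomsIn` (coherence / registration regions of a window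
  lie in `atomsIn 0 R'` once `‖x‖ + (28/25)(6C₁n+8) + r ≤ R'`), the packing bound `nK_atomsIn_le` (`≤ (2(D+1)/δ + 1)³`), and the count conversions
  `ncard_idxBall_le_ratio` (`#B_n ≤ (27/t³)·#B_{tn}`), `ncard_idxBall_le_nK_inter_ball` (index counts ≤ E3 masses, chains of chart 0).
* XL.2 ★ TOP SCALE `idxEnergy_pullDisp_top_le`: registration at scale `D = 9R` (`IsGlobalReg`, Direction B of the dictionary XG) prices the ORIGINAL pulled-back
  displacement on every window inside the root window: `E(φ₀)(B_{X₀,n}) ≤ dictB(C₁,δ)·(9·Cg·η·nK(atomsIn 0 (9R)))`.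
* XL.3 ★ REGIME (i) `bondEnergy_disp_iterate_le_of_cover`: if the index shadow of `S ∩ ball x ρ` (radius `(2ρ+8)·8/c₀`, chart 0, `4 ↦ 8` tear-free) lies in a
  window `B_{X₀,n}` whose energy is known for the iterate of chart i, then for the iterate of ANY chart k
  `bE(S ∩ ball x ρ)(p − Ψ_k p) ≤ dictA(c₀,8)·(2·E(φ_i)(B_n) + 54·Δ_{ik}²·#B_n)` (`Δ_{ik}` = index-Lipschitz constant of `lsite_k − lsite_i`; Dir A + history XK.4).
* XL.4 ★ REGIME (ii) `bondEnergy_disp_iterate_le_of_isGlobalReg`: beyond the tower, registration at scale `D ≥ R` with `‖x‖ + ρ ≤ D` gives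
  `bE(S ∩ ball x ρ)(p − Ψ_k p) ≤ 2(10/δ+1)³·Cg(D/R)η·nK(atomsIn 0 D) + 2(μ_k·8/c₀)²(10/δ+1)³·nK(S ∩ ball x ρ)` (XG + drift XF.4) — linear in `D`, which is what
  (I4ˢ)'s allowance `Θ·(ρ/τ)` affords; `bondEnergy_disp_self_eq` / `bondEnergy_disp_le_of_isGlobalReg` put the original `Ψ₀` in the same form.
* XL.5 MASSES: `cube_le_nK_inter_ball_of_le` (`(25ρ/(336C₁))³ ≤ nK(S ∩ ball x ρ)`, `ρ ≥ 21`), `ncard_idxBall_le_mass` (regime (i): `#B_n ≤ 27(336C₁A/25)³·nK(S ∩ ball x ρ)`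
  for `1 ≤ n ≤ Aρ`) and `nK_atomsIn_le_mass` (regime (ii): `nK(atomsIn 0 D) ≤ ((2B/δ+1/21)·336C₁/25)³·nK(S ∩ ball x ρ)` for `D + 1 ≤ Bρ`) convert both regimes
  into multiples of `nK(S ∩ ball x ρ)` — the currency of (I4ˢ)'s far budget and of [SBᵇ]'s claim.
-/

noncomputable section

open scoped BigOperators InnerProductSpace RealInnerProductSpace
open Set Function Metric
open Summit.AtomisticToContinuum.Crystallization.Theorems.ChartedPlanarOrderRigidityDoor (E3 IsClean IsNash atomsIn)
open Summit.AtomisticToContinuum.Crystallization.Theorems.ChartedPlanarOrderDensityDichotomy (μS IsSep nK nK_nonneg)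
open Summit.AtomisticToContinuum.Crystallization.Theorems.ChartedPlanarOrderCleanScaleP (IsCleanP isCleanP_one_iff)
open Summit.AtomisticToContinuum.Crystallization.Theorems.ChartedPlanarOrderDoorLayered (Layered atomsIn_subset)

namespace Summit.AtomisticToContinuum.Crystallization.Theorems.ChartedZeroExcessLayeredLatticeLiouville

/-! ### XL.1  Windows in the root window; packing and count conversions -/

section Windows

variable {S : Set E3} {Ψ : E3 → E3} {a b : E3} {w : ℤ → E3} {c C₁ δ : ℝ}

/-- a ball about `x` of radius `ρ` lies in the root window of radius `‖x‖ + ρ`. [formal bookkeeping] -/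
theorem inter_ball_subset_atomsIn {x : E3} {ρ D : ℝ} (h : ‖x‖ + ρ ≤ D) : S ∩ ball x ρ ⊆ atomsIn (μS S) 0 D := by
  rintro p ⟨hpS, hp⟩
  refine mem_atomsIn_iff.2 ⟨hpS, ?_⟩
  have h1 : ‖p - x‖ < ρ := by rw [← dist_eq_norm]; exact mem_ball.1 hp
  have h2 : ‖p‖ ≤ ‖p - x‖ + ‖x‖ := by
    calc ‖p‖ = ‖p - x + x‖ := by rw [sub_add_cancel]
      _ ≤ ‖p - x‖ + ‖x‖ := norm_add_le _ _
  linarith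

/-- the `r`-neighbourhoods of the atoms of a window lie in the root window `atomsIn 0 R'` once `‖x‖ + (28/25)(6C₁n + 8) + r ≤ R'` (chains, XD `dist_atomOf_le`). -/
theorem inter_closedBall_atomOf_subset_atomsIn (hbij : BijOn Ψ S (Layered a b w)) (hiso : IsBondIso S Ψ) (hH : IsClean (μS (Layered a b w)))
    (hT : IsTameIndexing C₁ a b w) (X₀ : Cell 2 × ℤ) {n r R' : ℝ} {X : Cell 2 × ℤ} (hX : X ∈ idxBall X₀ n)
    (hR : ‖atomOf S Ψ a b w X₀‖ + 28 / 25 * (6 * C₁ * n + 8) + r ≤ R') : S ∩ closedBall (atomOf S Ψ a b w X) r ⊆ atomsIn (μS S) 0 R' := by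
  rintro p ⟨hpS, hp⟩
  refine mem_atomsIn_iff.2 ⟨hpS, ?_⟩
  have hC : 0 ≤ C₁ := (norm_nonneg a).trans hT.1
  have hd : dist X X₀ ≤ n := hX
  have h1 : dist (atomOf S Ψ a b w X) (atomOf S Ψ a b w X₀) ≤ 28 / 25 * (6 * C₁ * n + 8) :=
    (dist_atomOf_le hbij hiso hH hT X₀ X).trans (by rw [dist_comm] at hd; nlinarith)
  have h2 : dist p (atomOf S Ψ a b w X) ≤ r := mem_closedBall.1 hp
  have h3 : ‖p‖ ≤ dist p (atomOf S Ψ a b w X) + dist (atomOf S Ψ a b w X) (atomOf S Ψ a b w X₀) + ‖atomOf S Ψ a b w X₀‖ := by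
    have := dist_triangle p (atomOf S Ψ a b w X) (atomOf S Ψ a b w X₀)
    have h' : ‖p‖ ≤ dist p (atomOf S Ψ a b w X₀) + ‖atomOf S Ψ a b w X₀‖ := by
      rw [dist_eq_norm]
      calc ‖p‖ = ‖p - atomOf S Ψ a b w X₀ + atomOf S Ψ a b w X₀‖ := by rw [sub_add_cancel]
        _ ≤ _ := norm_add_le _ _
    linarith
  linarith

/-- packing: the root window of radius `D` of a `δ`-separated set has `≤ (2(D+1)/δ + 1)³` atoms. [formal bookkeeping] -/
theorem nK_atomsIn_le (hδ : 0 < δ) (hsep : IsSep δ S) {D : ℝ} (hD : 0 ≤ D) : nK (atomsIn (μS S) 0 D) ≤ (2 * (D + 1) / δ + 1) ^ 3 := by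
  have hsub : atomsIn (μS S) 0 D ⊆ S ∩ ball 0 (D + 1) := by
    have h := inter_ball_subset_atomsIn (S := S) (x := 0) (ρ := D + 1) (D := D + 1) (by rw [norm_zero, zero_add])
    intro p hp
    obtain ⟨hpS, hpD⟩ := mem_atomsIn_iff.1 hp
    exact ⟨hpS, mem_ball_zero_iff.2 (by linarith)⟩
  calc nK (atomsIn (μS S) 0 D) = ((atomsIn (μS S) 0 D).ncard : ℝ) := rfl
    _ ≤ ((S ∩ ball 0 (D + 1)).ncard : ℝ) := by
        exact_mod_cast Set.ncard_le_ncard hsub (finite_inter_ball_of_isSep hδ hsep 0 (D + 1))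
    _ ≤ (2 * (D + 1) / δ + 1) ^ 3 := ncard_inter_ball_le_packing hδ hsep 0 (by linarith)

/-- count ratio between consecutive levels: `#B_n ≤ (27/t³)·#B_{tn}` (`n ≥ 1`, `0 < t`). [formal bookkeeping] -/
theorem ncard_idxBall_le_ratio (X₀ : Cell 2 × ℤ) {n t : ℝ} (hn : 1 ≤ n) (ht : 0 < t) :
    ((idxBall X₀ n).ncard : ℝ) ≤ 27 / t ^ 3 * ((idxBall X₀ (t * n)).ncard : ℝ) := by
  have h1 := ncard_idxBall_le_cube X₀ hn
  have h2 := cube_le_ncard_idxBall X₀ (m := t * n) (by positivity)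
  have ht3 : 0 < t ^ 3 := by positivity
  calc ((idxBall X₀ n).ncard : ℝ) ≤ 27 * n ^ 3 := h1
    _ = 27 / t ^ 3 * (t * n) ^ 3 := by field_simp
    _ ≤ 27 / t ^ 3 * ((idxBall X₀ (t * n)).ncard : ℝ) := mul_le_mul_of_nonneg_left h2 (by positivity)

/-- index counts are E3 masses: `#B_{X₀,n} ≤ nK(S ∩ ball x r)` for `r > (28/25)(6C₁n + 8)` (chains of the chart; XD). [formal bookkeeping] -/
theorem ncard_idxBall_le_nK_inter_ball (hbij : BijOn Ψ S (Layered a b w)) (hiso : IsBondIso S Ψ) (hH : IsClean (μS (Layered a b w)))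
    (hT : IsTameIndexing C₁ a b w) (hc : 0 < c) (hcr : IsLayeredCrystal c a b w) (hδ : 0 < δ) (hsep : IsSep δ S) (X₀ : Cell 2 × ℤ) {n r : ℝ}
    (hr : 28 / 25 * (6 * C₁ * n + 8) < r) : ((idxBall X₀ n).ncard : ℝ) ≤ nK (S ∩ ball (atomOf S Ψ a b w X₀) r) :=
  ncard_idxBall_le_ncard_inter_ball hbij hiso hH hT hc hcr hδ hsep X₀ hr

end Windows

/-! ### XL.2  The top scale: registration prices the original pulled-back displacement -/

section Top

variable {S : Set E3} {Ψ : E3 → E3} {a b : E3} {w : ℤ → E3} {c C₁ δ : ℝ}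

/-- ★ **TOP SCALE**: for the ORIGINAL registration `Ψ` (globally registered at `(Cg, η, R)`), every window `B_{X₀,n}` whose atoms' `(28/25)(6C₁+8)`-neighbourhoods
lie in the root window of radius `9R` has `E(φ₀)(B_{X₀,n}) ≤ dictB(C₁,δ)·(9·Cg·η·nK(atomsIn 0 (9R)))` (registration at `D = 9R` + Direction B, XG). [this file, g59] -/
theorem idxEnergy_pullDisp_top_le (hbij : BijOn Ψ S (Layered a b w)) (hiso : IsBondIso S Ψ) (hH : IsClean (μS (Layered a b w)))
    (hT : IsTameIndexing C₁ a b w) (hc : 0 < c) (hcr : IsLayeredCrystal c a b w) (hδ : 0 < δ) (hsep : IsSep δ S) {Cg η R : ℝ} (hR : 0 < R)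
    (hG : IsGlobalReg Cg η R S (Layered a b w) Ψ) (X₀ : Cell 2 × ℤ) {n : ℝ}
    (hwin : ‖atomOf S Ψ a b w X₀‖ + 28 / 25 * (6 * C₁ * n + 8) + 28 / 25 * (6 * C₁ + 8) ≤ 9 * R) :
    idxEnergy (pullDisp S Ψ a b w) (idxBall X₀ n) ≤ dictB C₁ δ * (9 * Cg * η * nK (atomsIn (μS S) 0 (9 * R))) := by
  obtain ⟨τ, hreg⟩ := hG.2.2.2 (9 * R) (by linarith)
  have h := idxEnergy_pullDisp_le_of_isRegistered hbij hiso hH hT hc hcr hδ hsep (finite_atomsIn hδ hsep (9 * R)) hreg X₀ n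
    fun X hX => inter_closedBall_atomOf_subset_atomsIn hbij hiso hH hT X₀ hX hwin
  have e : Cg * (9 * R / R) * η = 9 * Cg * η := by rw [mul_div_cancel_right₀ _ hR.ne']; ring
  rwa [e] at h

end Top

/-! ### XL.3  Regime (i): the tower covers the ball -/

section Cover

variable {S : Set E3} {Ψ₀ : E3 → E3} {a₀ b₀ a b a' b' : E3} {w₀ w w' : ℤ → E3} {c₀ c c' δ : ℝ}

/-- on `S` the original registration is its own transport (`transReg Ψ₀ a₀ b₀ w₀ a₀ b₀ w₀ = Ψ₀`), so its bond energies are iterate bond energies. -/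
theorem bondEnergy_disp_self_eq (hbij₀ : BijOn Ψ₀ S (Layered a₀ b₀ w₀)) {Q : Set E3} (hQS : Q ⊆ S) :
    bondEnergy Q (fun p => p - Ψ₀ p) = bondEnergy Q (fun p => p - transReg Ψ₀ a₀ b₀ w₀ a₀ b₀ w₀ p) :=
  bondEnergy_congr fun p hp => by rw [transReg_self_apply hbij₀ (hQS hp)]

/-- the index shadow (chart 0, `4 ↦ 8` tear-free) of `S ∩ ball x ρ` about the centre atom lies in `B_{X₀,n}` for `n ≥ (2ρ+8)·8/c₀`. [formal bookkeeping] -/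
theorem idxOf_mem_idxBall_of_mem_ball₀ (hS1 : IsCleanP 1 (μS S)) (hbij₀ : BijOn Ψ₀ S (Layered a₀ b₀ w₀)) (hc₀ : 0 < c₀)
    (hcr₀ : IsLayeredCrystal c₀ a₀ b₀ w₀) (h4D₀ : ∀ x ∈ S, ∀ p ∈ S, dist p x ≤ 4 → dist (Ψ₀ p) (Ψ₀ x) ≤ 8) (X₀ : Cell 2 × ℤ) {ρ n : ℝ}
    (hρ : 0 ≤ ρ) (hn : (2 * ρ + 8) * (8 / c₀) ≤ n) {p : E3} (hp : p ∈ S ∩ ball (atomOf S Ψ₀ a₀ b₀ w₀ X₀) ρ) :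
    idxOf a₀ b₀ w₀ (Ψ₀ p) ∈ idxBall X₀ n :=
  idxOf_mem_idxBall_of_mem_ball hS1 hbij₀ hc₀ hcr₀ (by norm_num) h4D₀ X₀ hρ hn hp

/-- ★ **REGIME (i)**: the bond energy of the displacement of the iterate of chart k on `S ∩ ball x ρ` is priced by the window energy of the iterate of ANY chart i
whose window contains the index shadow of the ball, plus the drift between the two charts:
`bE(S ∩ ball x ρ)(p − Ψ_k p) ≤ dictA(c₀,8)·(2·E(φ_i)(B_{X₀,n}) + 54·Δ²·#B_{X₀,n})`. [this file, g59] -/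
theorem bondEnergy_disp_iterate_le_of_cover (hS1 : IsCleanP 1 (μS S)) (hbij₀ : BijOn Ψ₀ S (Layered a₀ b₀ w₀)) (hc₀ : 0 < c₀)
    (hcr₀ : IsLayeredCrystal c₀ a₀ b₀ w₀) (h4D₀ : ∀ x ∈ S, ∀ p ∈ S, dist p x ≤ 4 → dist (Ψ₀ p) (Ψ₀ x) ≤ 8) (hδ : 0 < δ) (hsep : IsSep δ S)
    (hc : 0 < c) (hcr : IsLayeredCrystal c a b w) (hc' : 0 < c') (hcr' : IsLayeredCrystal c' a' b' w') {Δ : ℝ}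
    (hΔ : IsIdxLipschitz Δ (fun γ m => lsite a' b' w' γ m - lsite a b w γ m)) (X₀ : Cell 2 × ℤ) {ρ n : ℝ} (hρ : 0 ≤ ρ)
    (hn : (2 * ρ + 8) * (8 / c₀) ≤ n) :
    bondEnergy (S ∩ ball (atomOf S Ψ₀ a₀ b₀ w₀ X₀) ρ) (fun p => p - transReg Ψ₀ a₀ b₀ w₀ a' b' w' p) ≤
      dictA c₀ 8 * (2 * idxEnergy (pullDisp S (transReg Ψ₀ a₀ b₀ w₀ a b w) a b w) (idxBall X₀ n) + 54 * Δ ^ 2 * ((idxBall X₀ n).ncard : ℝ)) := by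
  set Q : Set E3 := S ∩ ball (atomOf S Ψ₀ a₀ b₀ w₀ X₀) ρ with hQ
  have hQS : Q ⊆ S := inter_subset_left
  have hQf : Q.Finite := finite_inter_ball_of_isSep hδ hsep _ ρ
  have hQB : ∀ p ∈ Q, idxOf a₀ b₀ w₀ (Ψ₀ p) ∈ idxBall X₀ n := fun p hp => idxOf_mem_idxBall_of_mem_ball₀ hS1 hbij₀ hc₀ hcr₀ h4D₀ X₀ hρ hn hp
  have h1 := bondEnergy_disp_transReg_le hbij₀ hc₀ hcr₀ hc' hcr' h4D₀ hQS hQf hQB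
  have h2 := idxEnergy_pullDisp_iterate_le_of_lipschitz hbij₀ hc₀ hcr₀ hc hcr hc' hcr' hΔ (idxBallF X₀ n)
  rw [coe_idxBallF] at h2
  have hN : ((idxBallF X₀ n).card : ℝ) = ((idxBall X₀ n).ncard : ℝ) := by rw [← coe_idxBallF, Set.ncard_coe_finset]
  rw [hN] at h2
  exact h1.trans (mul_le_mul_of_nonneg_left h2 (dictA_nonneg c₀ 8))

end Cover

/-! ### XL.4  Regime (ii): beyond the tower, registration at scale `D ≥ R` -/

section Far

variable {S : Set E3} {Ψ₀ : E3 → E3} {a₀ b₀ a' b' : E3} {w₀ w' : ℤ → E3} {c₀ δ : ℝ}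

/-- ★ **REGIME (ii)**: `bE(S ∩ ball x ρ)(p − Ψ_k p) ≤ 2(10/δ+1)³·(Cg(D/R)η·nK(atomsIn 0 D)) + 2(μ·8/c₀)²(10/δ+1)³·nK(S ∩ ball x ρ)` for every `D ≥ R` with
`S ∩ ball x ρ ⊆ atomsIn 0 D` (`μ` = index-Lipschitz constant of `lsite_k − lsite₀`; registration XG.1 + drift XF.4). [this file, g59] -/
theorem bondEnergy_disp_iterate_le_of_isGlobalReg (hbij₀ : BijOn Ψ₀ S (Layered a₀ b₀ w₀)) (hc₀ : 0 < c₀) (hcr₀ : IsLayeredCrystal c₀ a₀ b₀ w₀)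
    (hδ : 0 < δ) (hsep : IsSep δ S) {Cg η R : ℝ} (hG : IsGlobalReg Cg η R S (Layered a₀ b₀ w₀) Ψ₀) {μ : ℝ} (hμ0 : 0 ≤ μ)
    (hμ : IsIdxLipschitz μ (fun γ m => lsite a' b' w' γ m - lsite a₀ b₀ w₀ γ m)) {x : E3} {ρ D : ℝ} (hD : R ≤ D)
    (hsub : S ∩ ball x ρ ⊆ atomsIn (μS S) 0 D) :
    bondEnergy (S ∩ ball x ρ) (fun p => p - transReg Ψ₀ a₀ b₀ w₀ a' b' w' p) ≤
      2 * ((10 / δ + 1) ^ 3 * (Cg * (D / R) * η * nK (atomsIn (μS S) 0 D))) +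
        2 * ((μ * (8 / c₀)) ^ 2 * ((10 / δ + 1) ^ 3 * nK (S ∩ ball x ρ))) := by
  have hQS : S ∩ ball x ρ ⊆ S := inter_subset_left
  have hQf : (S ∩ ball x ρ).Finite := finite_inter_ball_of_isSep hδ hsep x ρ
  have h1 := bondEnergy_disp_transReg_le_of_disp hbij₀ hc₀ hcr₀ hμ0 hμ hG.2.1 hδ hsep hQS hQf
  obtain ⟨τ, hreg⟩ := hG.2.2.2 D hD
  have h2 : bondEnergy (S ∩ ball x ρ) (fun p => p - Ψ₀ p) ≤ bondEnergy (atomsIn (μS S) 0 D) (fun p => p - Ψ₀ p) :=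
    bondEnergy_mono (finite_atomsIn hδ hsep D) hsub _
  have h3 := bondEnergy_disp_le_of_isRegistered hδ hsep (atomsIn_subset S D) (finite_atomsIn hδ hsep D) hreg
  linarith

/-- REGIME (ii) for the original registration itself (`k = 0`, no drift): `bE(S ∩ ball x ρ)(p − Ψ₀ p) ≤ 2(10/δ+1)³·Cg(D/R)η·nK(atomsIn 0 D)`. [this file, g59] -/
theorem bondEnergy_disp_le_of_isGlobalReg (hbij₀ : BijOn Ψ₀ S (Layered a₀ b₀ w₀)) (hc₀ : 0 < c₀) (hcr₀ : IsLayeredCrystal c₀ a₀ b₀ w₀)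
    (hδ : 0 < δ) (hsep : IsSep δ S) {Cg η R : ℝ} (hG : IsGlobalReg Cg η R S (Layered a₀ b₀ w₀) Ψ₀) {x : E3} {ρ D : ℝ} (hD : R ≤ D)
    (hsub : S ∩ ball x ρ ⊆ atomsIn (μS S) 0 D) :
    bondEnergy (S ∩ ball x ρ) (fun p => p - Ψ₀ p) ≤ 2 * ((10 / δ + 1) ^ 3 * (Cg * (D / R) * η * nK (atomsIn (μS S) 0 D))) := by
  have h0 : IsIdxLipschitz 0 (fun γ m => lsite a₀ b₀ w₀ γ m - lsite a₀ b₀ w₀ γ m) := fun X Y => by simp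
  have h := bondEnergy_disp_iterate_le_of_isGlobalReg hbij₀ hc₀ hcr₀ hδ hsep hG le_rfl h0 hD hsub
  rw [bondEnergy_disp_self_eq hbij₀ inter_subset_left]
  simpa using h

end Far

/-! ### XL.5  Masses: index counts and root-window counts against `nK(S ∩ ball x ρ)` -/

section Mass

variable {S : Set E3} {Ψ : E3 → E3} {a b : E3} {w : ℤ → E3} {c C₁ δ : ℝ}

/-- mass from below at E3 scale: `(25ρ/(336C₁))³ ≤ nK(S ∩ ball x ρ)` for `ρ ≥ 21` (`x = atomOf X₀`; chains of the chart, XG `cube_le_nK_inter_ball`). -/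
theorem cube_le_nK_inter_ball_of_le (hbij : BijOn Ψ S (Layered a b w)) (hiso : IsBondIso S Ψ) (hH : IsClean (μS (Layered a b w)))
    (hT : IsTameIndexing C₁ a b w) (hc : 0 < c) (hcr : IsLayeredCrystal c a b w) (hδ : 0 < δ) (hsep : IsSep δ S) (hC₁ : 0 < C₁)
    (X₀ : Cell 2 × ℤ) {ρ : ℝ} (hρ : 21 ≤ ρ) : (25 * ρ / (336 * C₁)) ^ 3 ≤ nK (S ∩ ball (atomOf S Ψ a b w X₀) ρ) := by
  set m : ℝ := (25 * ρ / 28 - 9) / (6 * C₁) with hm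
  have hm0 : 0 ≤ m := by rw [hm]; exact div_nonneg (by linarith) (by positivity)
  have hr : 28 / 25 * (6 * C₁ * m + 8) < ρ := by
    have : 6 * C₁ * m = 25 * ρ / 28 - 9 := by rw [hm]; field_simp
    rw [this]; linarith
  have h := cube_le_nK_inter_ball hbij hiso hH hT hc hcr hδ hsep X₀ hm0 hr
  have hle : 25 * ρ / (336 * C₁) ≤ m := by
    rw [hm, div_le_div_iff₀ (by positivity) (by positivity)]; nlinarith
  exact (pow_le_pow_left₀ (by positivity) hle 3).trans h

/-- REGIME (i) MASS: `#B_{X₀,n} ≤ 27(336·C₁·A/25)³·nK(S ∩ ball x ρ)` for `1 ≤ n ≤ A·ρ`, `ρ ≥ 21`. [formal bookkeeping] -/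
theorem ncard_idxBall_le_mass (hbij : BijOn Ψ S (Layered a b w)) (hiso : IsBondIso S Ψ) (hH : IsClean (μS (Layered a b w)))
    (hT : IsTameIndexing C₁ a b w) (hc : 0 < c) (hcr : IsLayeredCrystal c a b w) (hδ : 0 < δ) (hsep : IsSep δ S) (hC₁ : 0 < C₁)
    (X₀ : Cell 2 × ℤ) {ρ n A : ℝ} (hρ : 21 ≤ ρ) (hn : 1 ≤ n) (hA : n ≤ A * ρ) :
    ((idxBall X₀ n).ncard : ℝ) ≤ 27 * (336 * C₁ * A / 25) ^ 3 * nK (S ∩ ball (atomOf S Ψ a b w X₀) ρ) := by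
  have h1 := ncard_idxBall_le_cube X₀ hn
  have h2 := cube_le_nK_inter_ball_of_le hbij hiso hH hT hc hcr hδ hsep hC₁ X₀ hρ
  have hA0 : 0 ≤ A := by
    by_contra hA'
    have : A * ρ < 0 := mul_neg_of_neg_of_pos (lt_of_not_ge hA') (by linarith)
    linarith
  have h3 : n ^ 3 ≤ (A * ρ) ^ 3 := pow_le_pow_left₀ (by linarith) hA 3
  have h4 : (A * ρ) ^ 3 = (336 * C₁ * A / 25) ^ 3 * (25 * ρ / (336 * C₁)) ^ 3 := by
    rw [← mul_pow]; congr 1; field_simp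
  calc ((idxBall X₀ n).ncard : ℝ) ≤ 27 * (A * ρ) ^ 3 := h1.trans (by linarith)
    _ = 27 * (336 * C₁ * A / 25) ^ 3 * (25 * ρ / (336 * C₁)) ^ 3 := by rw [h4]; ring
    _ ≤ 27 * (336 * C₁ * A / 25) ^ 3 * nK (S ∩ ball (atomOf S Ψ a b w X₀) ρ) := mul_le_mul_of_nonneg_left h2 (by positivity)

/-- REGIME (ii) MASS: `nK(atomsIn 0 D) ≤ ((2B/δ + 1/21)·336C₁/25)³·nK(S ∩ ball x ρ)` for `0 ≤ D`, `D + 1 ≤ B·ρ`, `ρ ≥ 21`. [formal bookkeeping] -/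
theorem nK_atomsIn_le_mass (hbij : BijOn Ψ S (Layered a b w)) (hiso : IsBondIso S Ψ) (hH : IsClean (μS (Layered a b w)))
    (hT : IsTameIndexing C₁ a b w) (hc : 0 < c) (hcr : IsLayeredCrystal c a b w) (hδ : 0 < δ) (hsep : IsSep δ S) (hC₁ : 0 < C₁)
    (X₀ : Cell 2 × ℤ) {ρ D B : ℝ} (hρ : 21 ≤ ρ) (hD : 0 ≤ D) (hB : D + 1 ≤ B * ρ) :
    nK (atomsIn (μS S) 0 D) ≤ ((2 * B / δ + 1 / 21) * (336 * C₁ / 25)) ^ 3 * nK (S ∩ ball (atomOf S Ψ a b w X₀) ρ) := by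
  have h1 := nK_atomsIn_le hδ hsep hD
  have h2 := cube_le_nK_inter_ball_of_le hbij hiso hH hT hc hcr hδ hsep hC₁ X₀ hρ
  have hB0 : 0 ≤ B := by
    by_contra hB'
    have : B * ρ < 0 := mul_neg_of_neg_of_pos (lt_of_not_ge hB') (by linarith)
    linarith
  have h3 : 2 * (D + 1) / δ + 1 ≤ (2 * B / δ + 1 / 21) * ρ := by
    have : 2 * (D + 1) / δ ≤ 2 * B / δ * ρ := by
      rw [div_mul_eq_mul_div]; exact div_le_div_of_nonneg_right (by nlinarith) hδ.le
    nlinarith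
  have h4 : (2 * (D + 1) / δ + 1) ^ 3 ≤ ((2 * B / δ + 1 / 21) * ρ) ^ 3 := pow_le_pow_left₀ (by positivity) h3 3
  have h5 : ((2 * B / δ + 1 / 21) * ρ) ^ 3 = ((2 * B / δ + 1 / 21) * (336 * C₁ / 25)) ^ 3 * (25 * ρ / (336 * C₁)) ^ 3 := by
    rw [← mul_pow]; congr 1; field_simp
  calc nK (atomsIn (μS S) 0 D) ≤ ((2 * B / δ + 1 / 21) * ρ) ^ 3 := h1.trans h4
    _ = ((2 * B / δ + 1 / 21) * (336 * C₁ / 25)) ^ 3 * (25 * ρ / (336 * C₁)) ^ 3 := h5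
    _ ≤ _ := mul_le_mul_of_nonneg_left h2 (by positivity)

end Mass

end Summit.AtomisticToContinuum.Crystallization.Theorems.ChartedZeroExcessLayeredLatticeLiouville

end
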